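import Mathlib
import HarnessLib
import Literature.NumberTheory.GaloisRepresentations.AdequateSubgroup
import Literature.NumberTheory.GaloisRepresentations.ExtendedAdequateSubgroup

/-!
# From the BLGGT clauses of adequacy to Thorne's 2012 notion when `p ∤ n` (helper for crux
`CoreAdequacySplit.NoAdequateLayerLifting`, line `birth`, stub `stub_rung_rank2_ell3`)

Def-free helper file.  Barnet-Lamb–Gee–Geraghty (Math. Ann. 2013, App. A, Def. A.1.1) and BLGGT
phrase "adequate" for a finite `H ≤ GL_n(𝔽̄_ℓ)` as: (1) `H¹(H, 𝔽̄_ℓ) = 0`, (2) `ℓ ∤ n`, (3) the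
elements of `H` of order prime to `ℓ` span `M_n(𝔽̄_ℓ)`, (4) `H¹(H, 𝔤𝔩_n(𝔽̄_ℓ)) = 0`, and remark
that this is equivalent to Thorne's 2012 Def. 2.3 (the tree's `Subgroup.IsThorneAdequate`: (i)
`H¹(H,k) = 0`, (ii) `H⁰(H, ad⁰) = 0`, (iii) `H¹(H, ad⁰) = 0`, (iv) the eigenprojection condition on
the simple submodules of `ad⁰`).  We PROVE the direction the crux needs, over an algebraically
closed coefficient field `k` with `n ≠ 0` in `k`:

* `adZeroRep_invariants_eq_bot_of_semisimpleSpan_eq_top` — (3) ⇒ (ii): an `H`-invariant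
  trace-zero matrix commutes with the spanning set, so is scalar (tree
  `mem_scalarMatrices_of_forall_commute`), and a trace-zero scalar vanishes as `n ≠ 0` in `k`;
* `adZeroRep_cocycles₁_le_coboundaries₁_of_adRep` — (4) ⇒ (iii): a `1`-cocycle `f : H → ad⁰` is
  a cocycle in `ad`, hence `f(h) = h M h⁻¹ − M`; replacing `M` by its trace-zero part
  `M − (tr M / n)·1` does not change `h M h⁻¹ − M`;
* `adZeroRep_exists_trace_eigenprojection_ne_zero` — (3) ⇒ (iv) over `k = k̄`: a simple
  `W ∋ w ≠ 0` has `tr(h w) ≠ 0` for some semisimple `h ∈ H` (non-degeneracy of the trace form and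
  (3)), and `tr(h w) = ∑_α α tr(e_{h,α} w)` (tree `exists_trace_mul_eq_sum`,
  `iSup_eigenspace_eq_top_of_coprime_orderOf`) — the argument of the tree's
  `Subgroup.IsExtendedAdequate.isThorne2017Adequate`, run inside `ad⁰`;
* `isThorneAdequate_of_span_of_adRep` — (1) ∧ (3) ∧ (4) ⇒ `Subgroup.IsThorneAdequate H`;
* `isThorneAdequate_of_isExtendedAdequate` — the same from the tree's extended notion
  (`Subgroup.IsExtendedAdequate`, clause (ii) `H¹(H, ad/Z) = 0`): a cocycle in `ad⁰` pushed to
  `ad/Z` is a coboundary `[h M h⁻¹ − M]`, and the scalar defect has trace `0`, so vanishes.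

References: Barnet-Lamb–Gee–Geraghty, Math. Ann. 356 (2013), App. A, Def. A.1.1 and the sentence
after it ("equivalent to [Thorne 2012] by the discussion following the definition of adequacy in
§2.1 of [BLGGT]"); Thorne, J. Inst. Math. Jussieu 11 (2012), Def. 2.3; Guralnick–Herzig–Taylor–
Thorne, appendix to loc. cit., Lemma 1.
-/

set_option linter.dupNamespace false

namespace Summit.Langlands.Langlands.Theorems.CoreAdequacy.NoAdequateLayer

open scoped MatrixGroups
open Literature.NumberTheory.GaloisRepresentations

universe u

variable {k : Type u} [Field k] {n : ℕ}

/-- An `H`-invariant element of `ad⁰` commutes with every element of `H`. [folklore] -/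
theorem commute_of_mem_adZeroRep_invariants (H : Subgroup (GL (Fin n) k))
    {M : (adZero (Fin n) k).toSubmodule} (hM : M ∈ (Subgroup.adZeroRep H).invariants) (h : H) :
    Commute (((h : GL (Fin n) k)) : Matrix (Fin n) (Fin n) k) (M : Matrix (Fin n) (Fin n) k) := by
  have hfix := (Representation.mem_invariants _ (M : (adZero (Fin n) k).toSubmodule)).1 hM h
  have e : (((h : GL (Fin n) k)) : Matrix (Fin n) (Fin n) k) * (M : Matrix (Fin n) (Fin n) k) *
      ((((h : GL (Fin n) k))⁻¹ : GL (Fin n) k) : Matrix (Fin n) (Fin n) k) =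
        (M : Matrix (Fin n) (Fin n) k) := by
    have e0 := congrArg Subtype.val hfix
    rwa [Subgroup.coe_adZeroRep_apply] at e0
  have e2 := congrArg (· * (((h : GL (Fin n) k)) : Matrix (Fin n) (Fin n) k)) e
  simp only [Matrix.mul_assoc, ← Units.val_mul, inv_mul_cancel, Units.val_one, Matrix.mul_one]
    at e2
  exact e2

/-- **BLGGT (3) ⇒ Thorne (ii).**  If the semisimple elements of `H` span `M_n(k)` and `n ≠ 0` in
`k`, then `H⁰(H, ad⁰) = 0`: an invariant trace-zero matrix is scalar (it commutes with a spanning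
set, tree `mem_scalarMatrices_of_forall_commute`), `c·1` with `n c = 0`, so `c = 0`. [folklore] -/
theorem adZeroRep_invariants_eq_bot_of_semisimpleSpan_eq_top (H : Subgroup (GL (Fin n) k))
    (hn : (n : k) ≠ 0) (hspan : Subgroup.semisimpleSpan H = ⊤) :
    (Subgroup.adZeroRep H).invariants = ⊥ := by
  rw [eq_bot_iff]
  intro M hM
  rw [Submodule.mem_bot]
  have hscal : (M : Matrix (Fin n) (Fin n) k) ∈ scalarMatrices (Fin n) k :=
    mem_scalarMatrices_of_forall_commute hspan fun h _ =>
      commute_of_mem_adZeroRep_invariants H hM h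
  obtain ⟨c, hc⟩ := (mem_scalarMatrices_iff _).1 hscal
  have htr : (M : Matrix (Fin n) (Fin n) k).trace = 0 := (mem_adZero_toSubmodule_iff _).1 M.2
  rw [← hc, Matrix.trace_smul, Matrix.trace_one, Fintype.card_fin, smul_eq_mul] at htr
  have hc0 : c = 0 := by
    rcases mul_eq_zero.1 htr with h0 | h0
    · exact h0
    · exact absurd h0 hn
  apply Subtype.ext
  change (M : Matrix (Fin n) (Fin n) k) = 0
  rw [← hc, hc0, zero_smul]

/-- **BLGGT (4) ⇒ Thorne (iii).**  If `H¹(H, ad) = 0` and `n ≠ 0` in `k` then `H¹(H, ad⁰) = 0`: a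
`1`-cocycle `f : H → ad⁰` is a `1`-cocycle in `ad`, so `f(h) = h M h⁻¹ − M` for some matrix `M`,
and then also `f(h) = h M⁰ h⁻¹ − M⁰` for the trace-zero `M⁰ = M − (tr M / n)·1`. [folklore] -/
theorem adZeroRep_cocycles₁_le_coboundaries₁_of_adRep (H : Subgroup (GL (Fin n) k))
    (hn : (n : k) ≠ 0)
    (h4 : groupCohomology.cocycles₁ (Rep.of (Subgroup.adRep H)) ≤
      groupCohomology.coboundaries₁ (Rep.of (Subgroup.adRep H))) :
    groupCohomology.cocycles₁ (Rep.of (Subgroup.adZeroRep H)) ≤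
      groupCohomology.coboundaries₁ (Rep.of (Subgroup.adZeroRep H)) := by
  rw [cocycles₁_le_coboundaries₁_iff_forall] at h4 ⊢
  intro f hf
  -- the cocycle pushed into `ad`
  have hf' : ∀ g h : H, (fun g => ((f g : (adZero (Fin n) k).toSubmodule) : Matrix (Fin n) (Fin n) k))
      (g * h) = (Rep.of (Subgroup.adRep H)).ρ g
        ((fun g => ((f g : (adZero (Fin n) k).toSubmodule) : Matrix (Fin n) (Fin n) k)) h) +
        (fun g => ((f g : (adZero (Fin n) k).toSubmodule) : Matrix (Fin n) (Fin n) k)) g := by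
    intro g h
    have e := congrArg Subtype.val (hf g h)
    simp only [Submodule.coe_add, Subgroup.coe_adZeroRep_apply] at e
    simp only [Subgroup.adRep_apply]
    exact e
  obtain ⟨M, hM⟩ :=
    h4 (fun g => ((f g : (adZero (Fin n) k).toSubmodule) : Matrix (Fin n) (Fin n) k)) hf'
  set c : k := (M.trace) / (n : k) with hc
  have hM0 : M - c • (1 : Matrix (Fin n) (Fin n) k) ∈ (adZero (Fin n) k).toSubmodule := by
    rw [mem_adZero_toSubmodule_iff, Matrix.trace_sub, Matrix.trace_smul, Matrix.trace_one,
      Fintype.card_fin, smul_eq_mul, hc, div_mul_cancel₀ _ hn, sub_self]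
  refine ⟨⟨M - c • 1, hM0⟩, fun g => ?_⟩
  apply Subtype.ext
  have e := hM g
  simp only [Subgroup.adRep_apply] at e
  simp only [Submodule.coe_sub, Subgroup.coe_adZeroRep_apply]
  rw [e, Matrix.mul_sub, Matrix.sub_mul, Matrix.mul_smul, Matrix.mul_one, Matrix.smul_mul,
    ← Units.val_mul, mul_inv_cancel, Units.val_one]
  abel

/-- **BLGGT (3) ⇒ Thorne (iv) over an algebraically closed field.**  If the semisimple elements of
`H` span `M_n(k)`, `k = k̄`, then every simple `k[H]`-submodule `W ⊆ ad⁰` contains `w` with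
`tr(e_{h,α} w) ≠ 0` for some `h ∈ H` of order prime to `p` and some `α`: pick `0 ≠ w ∈ W`; by
non-degeneracy of the trace pairing and the span condition some semisimple `h` has `tr(h w) ≠ 0`,
and `tr(h w) = ∑_α α tr(e_{h,α} w)` since `h` is diagonalisable (the argument of the tree's
`Subgroup.IsExtendedAdequate.isThorne2017Adequate`, inside `ad⁰`). [folklore] -/
theorem adZeroRep_exists_trace_eigenprojection_ne_zero [IsAlgClosed k]
    (H : Subgroup (GL (Fin n) k)) (hspan : Subgroup.semisimpleSpan H = ⊤)
    (W : Subrepresentation (Subgroup.adZeroRep H)) (hW : IsAtom W) :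
    ∃ h : H, (orderOf (h : GL (Fin n) k)).Coprime (ringChar k) ∧ ∃ α : k, ∃ w ∈ W,
      (eigenprojectionMatrix (((h : GL (Fin n) k)) : Matrix (Fin n) (Fin n) k) α *
        (w : Matrix (Fin n) (Fin n) k)).trace ≠ 0 := by
  obtain ⟨w, hw, hw0⟩ := Subrepresentation.exists_mem_ne_zero W hW.1
  have hw0' : (w : Matrix (Fin n) (Fin n) k) ≠ 0 := fun h0 =>
    hw0 (Subtype.ext (by rw [h0]; rfl))
  -- some semisimple `h ∈ H` has `tr(h w) ≠ 0`
  have hex : ∃ h : H, (orderOf (h : GL (Fin n) k)).Coprime (ringChar k) ∧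
      ((((h : GL (Fin n) k)) : Matrix (Fin n) (Fin n) k) * (w : Matrix (Fin n) (Fin n) k)).trace
        ≠ 0 := by
    by_contra hcon
    push Not at hcon
    have hall : ∀ m : Matrix (Fin n) (Fin n) k,
        (m * (w : Matrix (Fin n) (Fin n) k)).trace = 0 := by
      intro m
      have hm : m ∈ Subgroup.semisimpleSpan H := hspan ▸ Submodule.mem_top
      rw [Subgroup.semisimpleSpan] at hm
      refine Submodule.span_induction
        (p := fun m _ => (m * (w : Matrix (Fin n) (Fin n) k)).trace = 0) ?_ ?_ ?_ ?_ hm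
      · rintro _ ⟨h, hh, rfl⟩
        exact hcon h hh
      · rw [Matrix.zero_mul, Matrix.trace_zero]
      · intro x y _ _ hx hy
        rw [Matrix.add_mul, Matrix.trace_add, hx, hy, add_zero]
      · intro c x _ hx
        rw [Matrix.smul_mul, Matrix.trace_smul, hx, smul_zero]
    apply hw0'
    ext i j
    have hij := hall (Matrix.single j i 1)
    rwa [Matrix.trace_single_mul, one_smul] at hij
  obtain ⟨h, hh, htr⟩ := hex
  obtain ⟨S, hS⟩ := exists_trace_mul_eq_sum _
    (iSup_eigenspace_eq_top_of_coprime_orderOf (h : GL (Fin n) k) hh)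
  rw [hS] at htr
  obtain ⟨μ, -, hμ⟩ := Finset.exists_ne_zero_of_sum_ne_zero htr
  exact ⟨h, hh, μ, w, hw, fun h0 => hμ (by rw [h0, mul_zero])⟩

/-- **The BLGGT / BLGG 2013 (Def. A.1.1) clauses imply Thorne's 2012 adequacy when `p ∤ n`**, over
an algebraically closed field: (1) `Hom(H, k) = 0`, (3) the semisimple elements span `M_n(k)`,
(4) `H¹(H, ad) = 0`, and `n ≠ 0` in `k`, give `Subgroup.IsThorneAdequate H`. [folklore] -/
theorem isThorneAdequate_of_span_of_adRep [IsAlgClosed k] (H : Subgroup (GL (Fin n) k))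
    (hn : (n : k) ≠ 0) (h1 : ∀ f : Additive H →+ k, f = 0)
    (h3 : Subgroup.semisimpleSpan H = ⊤)
    (h4 : groupCohomology.cocycles₁ (Rep.of (Subgroup.adRep H)) ≤
      groupCohomology.coboundaries₁ (Rep.of (Subgroup.adRep H))) :
    Subgroup.IsThorneAdequate H where
  addMonoidHom_eq_zero := h1
  invariants_eq_bot := adZeroRep_invariants_eq_bot_of_semisimpleSpan_eq_top H hn h3
  cocycles₁_le_coboundaries₁ := adZeroRep_cocycles₁_le_coboundaries₁_of_adRep H hn h4
  exists_trace_eigenprojection_ne_zero := adZeroRep_exists_trace_eigenprojection_ne_zero H h3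

/-- **Extended (ii) ⇒ Thorne (iii).**  If `H¹(H, ad/Z) = 0` and `n ≠ 0` in `k` then
`H¹(H, ad⁰) = 0`: push a cocycle `f : H → ad⁰` to `ad/Z`, write it as `[h M h⁻¹ − M]`, replace
`M` by its trace-zero part; the defect `f(h) − (h M⁰ h⁻¹ − M⁰)` is scalar of trace `0`, hence `0`.
[folklore] -/
theorem adZeroRep_cocycles₁_le_coboundaries₁_of_adModScalarRep (H : Subgroup (GL (Fin n) k))
    (hn : (n : k) ≠ 0)
    (h2 : groupCohomology.cocycles₁ (Rep.of (Subgroup.adModScalarRep H)) ≤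
      groupCohomology.coboundaries₁ (Rep.of (Subgroup.adModScalarRep H))) :
    groupCohomology.cocycles₁ (Rep.of (Subgroup.adZeroRep H)) ≤
      groupCohomology.coboundaries₁ (Rep.of (Subgroup.adZeroRep H)) := by
  rw [cocycles₁_le_coboundaries₁_iff_forall] at h2 ⊢
  intro f hf
  set fq : H → Matrix (Fin n) (Fin n) k ⧸ scalarMatrices (Fin n) k :=
    fun g => (scalarMatrices (Fin n) k).mkQ ((f g : (adZero (Fin n) k).toSubmodule) :
      Matrix (Fin n) (Fin n) k) with hfq
  have hfq' : ∀ g h : H, fq (g * h) = (Rep.of (Subgroup.adModScalarRep H)).ρ g (fq h) + fq g := by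
    intro g h
    have e := congrArg Subtype.val (hf g h)
    simp only [Submodule.coe_add, Subgroup.coe_adZeroRep_apply] at e
    simp only [hfq, Subgroup.adModScalarRep_apply_mkQ, Subgroup.adRep_apply]
    rw [e, map_add]
  obtain ⟨m, hm⟩ := h2 fq hfq'
  obtain ⟨M, rfl⟩ := Submodule.mkQ_surjective (scalarMatrices (Fin n) k) m
  set c : k := (M.trace) / (n : k) with hc
  have hM0 : M - c • (1 : Matrix (Fin n) (Fin n) k) ∈ (adZero (Fin n) k).toSubmodule := by
    rw [mem_adZero_toSubmodule_iff, Matrix.trace_sub, Matrix.trace_smul, Matrix.trace_one,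
      Fintype.card_fin, smul_eq_mul, hc, div_mul_cancel₀ _ hn, sub_self]
  refine ⟨⟨M - c • 1, hM0⟩, fun g => ?_⟩
  apply Subtype.ext
  simp only [Submodule.coe_sub, Subgroup.coe_adZeroRep_apply]
  -- the defect is scalar ...
  have e := hm g
  simp only [hfq, Subgroup.adModScalarRep_apply_mkQ, Subgroup.adRep_apply] at e
  rw [← map_sub, Submodule.mkQ_apply, Submodule.mkQ_apply, Submodule.Quotient.eq,
    mem_scalarMatrices_iff] at e
  obtain ⟨d, hd⟩ := e
  -- ... and has trace zero
  set gM : Matrix (Fin n) (Fin n) k := (((g : GL (Fin n) k)) : Matrix (Fin n) (Fin n) k) with hgM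
  set gMi : Matrix (Fin n) (Fin n) k := ((((g : GL (Fin n) k))⁻¹ : GL (Fin n) k) :
    Matrix (Fin n) (Fin n) k) with hgMi
  have hconj : gM * (M - c • 1) * gMi - (M - c • 1) = gM * M * gMi - M := by
    rw [Matrix.mul_sub, Matrix.sub_mul, Matrix.mul_smul, Matrix.mul_one, Matrix.smul_mul, hgM,
      hgMi, ← Units.val_mul, mul_inv_cancel, Units.val_one]
    abel
  have htrf : (((f g : (adZero (Fin n) k).toSubmodule) : Matrix (Fin n) (Fin n) k)).trace = 0 :=
    (mem_adZero_toSubmodule_iff _).1 (f g).2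
  have htrc : (gM * M * gMi - M).trace = 0 := by
    rw [Matrix.trace_sub, Matrix.trace_mul_cycle, hgMi, hgM, ← Units.val_mul, inv_mul_cancel,
      Units.val_one, Matrix.one_mul, sub_self]
  have hd0 : d = 0 := by
    have ht := congrArg Matrix.trace hd
    rw [Matrix.trace_smul, Matrix.trace_one, Fintype.card_fin, smul_eq_mul, Matrix.trace_sub,
      htrf, htrc, sub_zero] at ht
    rcases mul_eq_zero.1 ht with h0 | h0
    · exact h0
    · exact absurd h0 hn
  rw [hd0, zero_smul, eq_comm, sub_eq_zero] at hd
  rw [hconj, hd]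

/-- **Extended adequacy implies Thorne's 2012 adequacy when `p ∤ n`** (over `k = k̄`): the tree's
`Subgroup.IsExtendedAdequate` (GHT 2017 §1 / Thorne 2017 Def. 2.20) gives
`Subgroup.IsThorneAdequate` as soon as `n ≠ 0` in `k` (GHT 2017, §1: "if `p ∤ dim V`, `k` is a
direct summand of `V* ⊗ V` and the two notions agree"). [folklore] -/
theorem isThorneAdequate_of_isExtendedAdequate [IsAlgClosed k] (H : Subgroup (GL (Fin n) k))
    (hn : (n : k) ≠ 0) (hH : Subgroup.IsExtendedAdequate H) : Subgroup.IsThorneAdequate H where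
  addMonoidHom_eq_zero := hH.addMonoidHom_eq_zero
  invariants_eq_bot :=
    adZeroRep_invariants_eq_bot_of_semisimpleSpan_eq_top H hn hH.semisimpleSpan_eq_top
  cocycles₁_le_coboundaries₁ :=
    adZeroRep_cocycles₁_le_coboundaries₁_of_adModScalarRep H hn hH.cocycles₁_le_coboundaries₁
  exists_trace_eigenprojection_ne_zero :=
    adZeroRep_exists_trace_eigenprojection_ne_zero H hH.semisimpleSpan_eq_top

end Summit.Langlands.Langlands.Theorems.CoreAdequacy.NoAdequateLayer
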